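import Mathlib
import Summits.ValiantsHypothesis.ValiantsHypothesis.Theorems.NewtonUnitEquationsNewtonTauWeakWeightedLevelSetQuasi

/-!
# `NewtonUnitEquationsNewtonTauWeakMultiGradedQuasi` — THEOREM W-multi-quasi: hull counts of MULTI-graded level sets

Line `binomial-normal-form` of crux `NewtonTauWeak` (stmt-ValiantsHypothesis-5904), QUASI rung, multiplicative rank `s`
(registered stubs `multiLevelSetPhi_le`, `multiLevelSetHull_quasi`).

Setting.  Items `j : Fin N` with VECTOR weights `g j : Fin s → ℕ` (`s` gradings; `g j ≠ 0`, all components `≤ c`) and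
exponents `d j ∈ ℕ²` (coincidences allowed); the multi-level set of subset sums at level `v : Fin s → ℕ` is
`X_v = {Σ_{j ∈ J} d j : Σ_{j ∈ J} g j = v} ⊆ ℕ²` — on a dissociated list this is the support of a design of multiplicative
rank `s` (`ρ_{lj} = Π_i u_{l,i}^{g j i} ρ_j` over a product grid of nodes), the regime that THEOREM W (rank one) and the
residue designs (block gradings) do not reach.  `U σ S` (parameter characterised by `hU`) is the set of unique maximisers of
`t·x + σ·y` over `S` for some real `t`; `Φ S = |U 1 S| + |U (-1) S|`.

* (`multiLevelSetPhi_le`)  `Φ X_v ≤ 2 (2 (cN + 1)^s)^k` whenever `N ≤ 2^k`.  HALVING as in the rank-one file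
  (…WeightedLevelSetQuasi): `X_v = ⋃_{v₁ + v₂ = v} X_{v₁}(half 1) + X_{v₂}(half 2)` over the `≤ (c n₁ + 1)^s` achievable
  weight vectors `v₁` of the first half (`MultiGradedQuasiAux.levelSet_split`), union subadditivity of `U`
  (`QuasiAux.U_biUnion_subset`) and Minkowski subadditivity (`card_uniqueMax_add_le`).
* (`multiLevelSetHull_quasi`)  Hence `#ext conv X_v ≤ 2 (2 (cN + 1)^s)^k + 2` (`ncard_extremePoints_le_card_uniqueMax`):
  quasi-polynomial `N^{O(s log(cN))}`, uniformly in the number of products of the design.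

Folklore (planar convexity, counting); no named facts, no citations, no `def`s.
-/

-- Sub = Summit single-conjunct layout: the duplicated namespace component is mandated by the tree.
set_option linter.dupNamespace false

noncomputable section

open scoped BigOperators

namespace Summit.ValiantsHypothesis.ValiantsHypothesis.Theorems.NewtonUnitEquationsNewtonTauWeak

namespace MultiGradedQuasiAux

variable (U : ℝ → Finset (Fin 2 →₀ ℕ) → Finset (Fin 2 →₀ ℕ))
  (hU : ∀ (σ : ℝ) (S : Finset (Fin 2 →₀ ℕ)) (s : Fin 2 →₀ ℕ), s ∈ U σ S ↔ s ∈ S ∧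
    ∃ t : ℝ, ∀ s' ∈ S, s' ≠ s →
      t * ((s' 0 : ℕ) : ℝ) + σ * ((s' 1 : ℕ) : ℝ) < t * ((s 0 : ℕ) : ℝ) + σ * ((s 1 : ℕ) : ℝ))
include hU

omit hU in
/-- **Splitting the items (vector weights).**  For items indexed by `Fin (n₁ + n₂)` with weights in an additive
commutative monoid, the level-`v` set of subset sums is the union, over the pairs `(v₁, v₂)` of achievable half
weights with `v₁ + v₂ = v`, of the Minkowski sums of the half level sets (`Fin.castAdd` / `Fin.natAdd` halves).
[folklore] -/
theorem levelSet_split {M : Type} [AddCommMonoid M] [DecidableEq M] (n₁ n₂ : ℕ) (v : M)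
    (g : Fin (n₁ + n₂) → M) (d : Fin (n₁ + n₂) → (Fin 2 →₀ ℕ)) :
    ((Finset.univ.filter fun J : Finset (Fin (n₁ + n₂)) => ∑ j ∈ J, g j = v).image fun J => ∑ j ∈ J, d j) =
      ((((Finset.univ : Finset (Finset (Fin n₁))).image fun J => ∑ j ∈ J, g (Fin.castAdd n₂ j)) ×ˢ
          ((Finset.univ : Finset (Finset (Fin n₂))).image fun J => ∑ j ∈ J, g (Fin.natAdd n₁ j))).filter
          fun p => p.1 + p.2 = v).biUnion fun p =>
        ((((Finset.univ.filter fun J : Finset (Fin n₁) => ∑ j ∈ J, g (Fin.castAdd n₂ j) = p.1).image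
            fun J => ∑ j ∈ J, d (Fin.castAdd n₂ j)) ×ˢ
          ((Finset.univ.filter fun J : Finset (Fin n₂) => ∑ j ∈ J, g (Fin.natAdd n₁ j) = p.2).image
            fun J => ∑ j ∈ J, d (Fin.natAdd n₁ j))).image fun q => q.1 + q.2) := by
  classical
  -- traces of a subset on the two halves, and the splitting of sums
  have hsplit : ∀ {M' : Type} [AddCommMonoid M'] (f : Fin (n₁ + n₂) → M') (J : Finset (Fin (n₁ + n₂))),
      ∑ j ∈ J, f j = ∑ i ∈ Finset.univ.filter (fun i : Fin n₁ => Fin.castAdd n₂ i ∈ J), f (Fin.castAdd n₂ i) +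
        ∑ i ∈ Finset.univ.filter (fun i : Fin n₂ => Fin.natAdd n₁ i ∈ J), f (Fin.natAdd n₁ i) := by
    intro M' _ f J
    rw [Finset.sum_filter, Finset.sum_filter, ← Fin.sum_univ_add (f := fun j => if j ∈ J then f j else 0),
      ← Finset.sum_filter, Finset.filter_mem_eq_inter, Finset.univ_inter]
  ext p
  constructor
  · intro hp
    obtain ⟨J, hJ, rfl⟩ := Finset.mem_image.1 hp
    have hJv : ∑ j ∈ J, g j = v := (Finset.mem_filter.1 hJ).2
    set J₁ := Finset.univ.filter (fun i : Fin n₁ => Fin.castAdd n₂ i ∈ J) with hJ₁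
    set J₂ := Finset.univ.filter (fun i : Fin n₂ => Fin.natAdd n₁ i ∈ J) with hJ₂
    refine Finset.mem_biUnion.2 ⟨(∑ j ∈ J₁, g (Fin.castAdd n₂ j), ∑ j ∈ J₂, g (Fin.natAdd n₁ j)),
      Finset.mem_filter.2 ⟨Finset.mem_product.2 ⟨Finset.mem_image.2 ⟨J₁, Finset.mem_univ _, rfl⟩,
        Finset.mem_image.2 ⟨J₂, Finset.mem_univ _, rfl⟩⟩, by rw [← hsplit g J, hJv]⟩, ?_⟩
    refine Finset.mem_image.2 ⟨(∑ j ∈ J₁, d (Fin.castAdd n₂ j), ∑ j ∈ J₂, d (Fin.natAdd n₁ j)),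
      Finset.mem_product.2 ⟨Finset.mem_image.2 ⟨J₁, Finset.mem_filter.2 ⟨Finset.mem_univ _, rfl⟩, rfl⟩,
        Finset.mem_image.2 ⟨J₂, Finset.mem_filter.2 ⟨Finset.mem_univ _, rfl⟩, rfl⟩⟩, (hsplit d J).symm⟩
  · intro hp
    obtain ⟨⟨v₁, v₂⟩, hvv, hp⟩ := Finset.mem_biUnion.1 hp
    have hv : v₁ + v₂ = v := (Finset.mem_filter.1 hvv).2
    obtain ⟨⟨p₁, p₂⟩, hpp, rfl⟩ := Finset.mem_image.1 hp
    obtain ⟨hp₁, hp₂⟩ := Finset.mem_product.1 hpp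
    obtain ⟨J₁, hJ₁, rfl⟩ := Finset.mem_image.1 hp₁
    obtain ⟨J₂, hJ₂, rfl⟩ := Finset.mem_image.1 hp₂
    have hJ₁v : ∑ j ∈ J₁, g (Fin.castAdd n₂ j) = v₁ := (Finset.mem_filter.1 hJ₁).2
    have hJ₂v : ∑ j ∈ J₂, g (Fin.natAdd n₁ j) = v₂ := (Finset.mem_filter.1 hJ₂).2
    -- glue the two traces
    have h1 : (Finset.univ.filter fun i : Fin n₁ =>
        Fin.castAdd n₂ i ∈ J₁.image (Fin.castAdd n₂) ∪ J₂.image (Fin.natAdd n₁)) = J₁ := by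
      ext i
      simp only [Finset.mem_filter, Finset.mem_univ, true_and, Finset.mem_union, Finset.mem_image]
      constructor
      · rintro (⟨i', hi', h⟩ | ⟨i', _, h⟩)
        · rwa [← Fin.castAdd_injective _ _ h]
        · exact absurd (congrArg Fin.val h) (by simp only [Fin.val_natAdd, Fin.val_castAdd]; omega)
      · exact fun hi => Or.inl ⟨i, hi, rfl⟩
    have h2 : (Finset.univ.filter fun i : Fin n₂ =>
        Fin.natAdd n₁ i ∈ J₁.image (Fin.castAdd n₂) ∪ J₂.image (Fin.natAdd n₁)) = J₂ := by
      ext i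
      simp only [Finset.mem_filter, Finset.mem_univ, true_and, Finset.mem_union, Finset.mem_image]
      constructor
      · rintro (⟨i', _, h⟩ | ⟨i', hi', h⟩)
        · exact absurd (congrArg Fin.val h) (by simp only [Fin.val_natAdd, Fin.val_castAdd]; omega)
        · rwa [← Fin.natAdd_injective _ _ h]
      · exact fun hi => Or.inr ⟨i, hi, rfl⟩
    refine Finset.mem_image.2 ⟨J₁.image (Fin.castAdd n₂) ∪ J₂.image (Fin.natAdd n₁),
      Finset.mem_filter.2 ⟨Finset.mem_univ _, ?_⟩, ?_⟩
    · rw [hsplit g, h1, h2, hJ₁v, hJ₂v, hv]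
    · simp only [hsplit d, h1, h2]

omit hU in
/-- The achievable weight vectors of subsets of `n` items with components `≤ c` number at most `(c n + 1)^s`.
[folklore] -/
theorem card_weights_le (s n c : ℕ) (g : Fin n → Fin s → ℕ) (hg : ∀ j i, g j i ≤ c) :
    ((Finset.univ : Finset (Finset (Fin n))).image fun J => ∑ j ∈ J, g j).card ≤ (c * n + 1) ^ s := by
  classical
  calc _ ≤ (Fintype.piFinset fun _ : Fin s => Finset.range (c * n + 1)).card :=
        Finset.card_le_card fun w hw => ?_
    _ = (c * n + 1) ^ s := by
        rw [Fintype.card_piFinset, Finset.prod_const, Finset.card_range, Finset.card_univ, Fintype.card_fin]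
  obtain ⟨J, -, rfl⟩ := Finset.mem_image.1 hw
  refine Fintype.mem_piFinset.2 fun i => Finset.mem_range.2 (Nat.lt_succ_of_le ?_)
  rw [Finset.sum_apply]
  calc ∑ j ∈ J, g j i ≤ ∑ j, g j i := Finset.sum_le_sum_of_subset (Finset.subset_univ J)
    _ ≤ ∑ _j : Fin n, c := Finset.sum_le_sum fun j _ => hg j i
    _ = c * n := by rw [Finset.sum_const, Finset.card_univ, Fintype.card_fin, smul_eq_mul, Nat.mul_comm]

/-- With at most one item of nonzero weight a multi-level set has at most one point, so `Φ ≤ 2`. [folklore] -/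
theorem phi_le_two (s N : ℕ) (v : Fin s → ℕ) (hN : N ≤ 1) (g : Fin N → Fin s → ℕ) (hg0 : ∀ j, g j ≠ 0)
    (d : Fin N → (Fin 2 →₀ ℕ)) :
    (U 1 (((Finset.univ.filter fun J : Finset (Fin N) => ∑ j ∈ J, g j = v).image
        fun J => ∑ j ∈ J, d j))).card +
      (U (-1) (((Finset.univ.filter fun J : Finset (Fin N) => ∑ j ∈ J, g j = v).image
        fun J => ∑ j ∈ J, d j))).card ≤ 2 := by
  classical
  have hcard : ((Finset.univ.filter fun J : Finset (Fin N) => ∑ j ∈ J, g j = v).image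
      fun J => ∑ j ∈ J, d j).card ≤ 1 := by
    refine Finset.card_image_le.trans (Finset.card_le_one.2 fun J hJ J' hJ' => ?_)
    have hJv := (Finset.mem_filter.1 hJ).2
    have hJ'v := (Finset.mem_filter.1 hJ').2
    rcases N with _ | _ | N
    · rw [Finset.eq_empty_of_isEmpty J, Finset.eq_empty_of_isEmpty J']
    · rcases Finset.subset_singleton_iff.1 (show J ⊆ {0} from fun x _ => by
          rw [Finset.mem_singleton]; exact Fin.eq_zero x) with rfl | rfl <;>
        rcases Finset.subset_singleton_iff.1 (show J' ⊆ {0} from fun x _ => by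
          rw [Finset.mem_singleton]; exact Fin.eq_zero x) with rfl | rfl
      · rfl
      · rw [Finset.sum_empty] at hJv
        rw [Finset.sum_singleton] at hJ'v
        exact absurd (hJ'v.trans hJv.symm) (hg0 0)
      · rw [Finset.sum_empty] at hJ'v
        rw [Finset.sum_singleton] at hJv
        exact absurd (hJv.trans hJ'v.symm) (hg0 0)
      · rfl
    · omega
  have h1 := (Finset.card_le_card (QuasiAux.U_subset U hU 1 _)).trans hcard
  have h2 := (Finset.card_le_card (QuasiAux.U_subset U hU (-1) _)).trans hcard
  omega

end MultiGradedQuasiAux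

/-- **Halving bound for `Φ = |U 1 ·| + |U (-1) ·|` on multi-graded level sets, registered stub
`multiLevelSetPhi_le`.**  For vector weights `g j : Fin s → ℕ`, nonzero with components `≤ c`, on `N ≤ 2^k` items and
any exponents, the level set `X_v = {Σ_{j ∈ J} d j : Σ_{j ∈ J} g j = v}` has `Φ X_v ≤ 2 (2 (cN + 1)^s)^k`.  Induction on
`k`: split into halves of sizes `≤ 2^(k-1)`; by `MultiGradedQuasiAux.levelSet_split`, union subadditivity, Minkowski
subadditivity (`card_uniqueMax_add_le`) and the count `≤ (c n₁ + 1)^s` of achievable first-half weight vectors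
(`MultiGradedQuasiAux.card_weights_le`; for each of them at most one second-half weight fits),
`Φ(N) ≤ (c n₁ + 1)^s · (Φ(n₁) + Φ(n₂))`. [folklore] -/
theorem multiLevelSetPhi_le
    (U : ℝ → Finset (Fin 2 →₀ ℕ) → Finset (Fin 2 →₀ ℕ))
    (hU : ∀ (σ : ℝ) (S : Finset (Fin 2 →₀ ℕ)) (s : Fin 2 →₀ ℕ), s ∈ U σ S ↔ s ∈ S ∧
      ∃ t : ℝ, ∀ s' ∈ S, s' ≠ s →
        t * ((s' 0 : ℕ) : ℝ) + σ * ((s' 1 : ℕ) : ℝ) < t * ((s 0 : ℕ) : ℝ) + σ * ((s 1 : ℕ) : ℝ))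
    (s k N c : ℕ) (v : Fin s → ℕ) (hN : N ≤ 2 ^ k) (g : Fin N → Fin s → ℕ) (hg0 : ∀ j, g j ≠ 0)
    (hgc : ∀ j i, g j i ≤ c) (d : Fin N → (Fin 2 →₀ ℕ)) :
    (U 1 (((Finset.univ.filter fun J : Finset (Fin N) => ∑ j ∈ J, g j = v).image
        fun J => ∑ j ∈ J, d j))).card +
      (U (-1) (((Finset.univ.filter fun J : Finset (Fin N) => ∑ j ∈ J, g j = v).image
        fun J => ∑ j ∈ J, d j))).card ≤ 2 * (2 * (c * N + 1) ^ s) ^ k := by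
  classical
  induction k generalizing N v with
  | zero =>
    rw [pow_zero, mul_one]
    exact MultiGradedQuasiAux.phi_le_two U hU s N v (by simpa using hN) g hg0 d
  | succ k ih =>
    by_cases hNk : N ≤ 2 ^ k
    · refine (ih N v hNk g hg0 hgc d).trans (Nat.mul_le_mul_left 2 ?_)
      exact Nat.pow_le_pow_right (by positivity) (Nat.le_succ k)
    obtain ⟨n₁, n₂, rfl, hn₁, hn₂⟩ : ∃ n₁ n₂, N = n₁ + n₂ ∧ n₁ ≤ 2 ^ k ∧ n₂ ≤ 2 ^ k :=
      ⟨N / 2, N - N / 2, by omega, by rw [pow_succ] at hN; omega, by rw [pow_succ] at hN; omega⟩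
    -- the two half instances and their level sets
    set g₁ : Fin n₁ → Fin s → ℕ := fun i => g (Fin.castAdd n₂ i) with hg₁
    set g₂ : Fin n₂ → Fin s → ℕ := fun i => g (Fin.natAdd n₁ i) with hg₂
    set d₁ : Fin n₁ → (Fin 2 →₀ ℕ) := fun i => d (Fin.castAdd n₂ i) with hd₁
    set d₂ : Fin n₂ → (Fin 2 →₀ ℕ) := fun i => d (Fin.natAdd n₁ i) with hd₂
    set A : (Fin s → ℕ) → Finset (Fin 2 →₀ ℕ) := fun v₁ =>
      ((Finset.univ.filter fun J : Finset (Fin n₁) => ∑ j ∈ J, g₁ j = v₁).image fun J => ∑ j ∈ J, d₁ j) with hA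
    set B : (Fin s → ℕ) → Finset (Fin 2 →₀ ℕ) := fun v₂ =>
      ((Finset.univ.filter fun J : Finset (Fin n₂) => ∑ j ∈ J, g₂ j = v₂).image fun J => ∑ j ∈ J, d₂ j) with hB
    set W₁ : Finset (Fin s → ℕ) := (Finset.univ : Finset (Finset (Fin n₁))).image fun J => ∑ j ∈ J, g₁ j with hW₁
    set W₂ : Finset (Fin s → ℕ) := (Finset.univ : Finset (Finset (Fin n₂))).image fun J => ∑ j ∈ J, g₂ j with hW₂
    set I : Finset ((Fin s → ℕ) × (Fin s → ℕ)) := (W₁ ×ˢ W₂).filter fun p => p.1 + p.2 = v with hI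
    have hsplit := MultiGradedQuasiAux.levelSet_split n₁ n₂ v g d
    -- per sign: union and Minkowski subadditivity
    have hσ : ∀ σ : ℝ, (U σ (((Finset.univ.filter fun J : Finset (Fin (n₁ + n₂)) => ∑ j ∈ J, g j = v).image
        fun J => ∑ j ∈ J, d j))).card ≤ ∑ p ∈ I, ((U σ (A p.1)).card + (U σ (B p.2)).card) := by
      intro σ
      rw [hsplit]
      refine (Finset.card_le_card (QuasiAux.U_biUnion_subset U hU σ _ _)).trans
        (Finset.card_biUnion_le.trans ?_)
      exact Finset.sum_le_sum fun p _ => card_uniqueMax_add_le U hU σ (A p.1) (B p.2)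
    -- the number of contributing pairs
    have hIcard : I.card ≤ (c * n₁ + 1) ^ s := by
      refine le_trans ?_ (MultiGradedQuasiAux.card_weights_le s n₁ c g₁ fun j i => hgc _ i)
      refine Finset.card_le_card_of_injOn Prod.fst (fun p hp => ?_) fun p hp q hq hpq => ?_
      · exact Finset.mem_coe.2 (Finset.mem_product.1 (Finset.mem_filter.1 hp).1).1
      · have hp' := (Finset.mem_filter.1 (Finset.mem_coe.1 hp)).2
        have hq' := (Finset.mem_filter.1 (Finset.mem_coe.1 hq)).2
        refine Prod.ext hpq (add_left_cancel (a := p.1) ?_)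
        rw [hp', show p.1 = q.1 from hpq, hq']
    -- the induction hypothesis on the halves
    have hA' : ∀ v₁, (U 1 (A v₁)).card + (U (-1) (A v₁)).card ≤ 2 * (2 * (c * n₁ + 1) ^ s) ^ k :=
      fun v₁ => ih n₁ v₁ hn₁ g₁ (fun i => hg0 _) (fun i => hgc _) d₁
    have hB' : ∀ v₂, (U 1 (B v₂)).card + (U (-1) (B v₂)).card ≤ 2 * (2 * (c * n₂ + 1) ^ s) ^ k :=
      fun v₂ => ih n₂ v₂ hn₂ g₂ (fun i => hg0 _) (fun i => hgc _) d₂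
    have hT₁ : (2 * (c * n₁ + 1) ^ s) ^ k ≤ (2 * (c * (n₁ + n₂) + 1) ^ s) ^ k :=
      Nat.pow_le_pow_left (Nat.mul_le_mul_left 2 (Nat.pow_le_pow_left (by nlinarith [Nat.zero_le (c * n₂)]) s)) k
    have hT₂ : (2 * (c * n₂ + 1) ^ s) ^ k ≤ (2 * (c * (n₁ + n₂) + 1) ^ s) ^ k :=
      Nat.pow_le_pow_left (Nat.mul_le_mul_left 2 (Nat.pow_le_pow_left (by nlinarith [Nat.zero_le (c * n₁)]) s)) k
    have hW : (c * n₁ + 1) ^ s ≤ (c * (n₁ + n₂) + 1) ^ s :=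
      Nat.pow_le_pow_left (by nlinarith [Nat.zero_le (c * n₂)]) s
    calc _ ≤ ∑ p ∈ I, (((U 1 (A p.1)).card + (U (-1) (A p.1)).card) +
          ((U 1 (B p.2)).card + (U (-1) (B p.2)).card)) := by
          refine (Nat.add_le_add (hσ 1) (hσ (-1))).trans (le_of_eq ?_)
          rw [← Finset.sum_add_distrib]
          exact Finset.sum_congr rfl fun p _ => by ring
      _ ≤ ∑ _p ∈ I, (2 * (2 * (c * n₁ + 1) ^ s) ^ k + 2 * (2 * (c * n₂ + 1) ^ s) ^ k) :=
          Finset.sum_le_sum fun p _ => Nat.add_le_add (hA' p.1) (hB' p.2)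
      _ = I.card * (2 * (2 * (c * n₁ + 1) ^ s) ^ k + 2 * (2 * (c * n₂ + 1) ^ s) ^ k) := by
          rw [Finset.sum_const, smul_eq_mul]
      _ ≤ (c * (n₁ + n₂) + 1) ^ s *
          (2 * (2 * (c * (n₁ + n₂) + 1) ^ s) ^ k + 2 * (2 * (c * (n₁ + n₂) + 1) ^ s) ^ k) :=
          Nat.mul_le_mul (hIcard.trans hW) (by omega)
      _ = 2 * (2 * (c * (n₁ + n₂) + 1) ^ s) ^ (k + 1) := by ring

/-- **THEOREM W-multi-quasi (hull vertices of multi-graded level sets), registered stub `multiLevelSetHull_quasi`.**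
For vector weights `g j : Fin s → ℕ`, nonzero with components `≤ c`, on `N ≤ 2^k` items and any exponents `d j ∈ ℕ²`,
the convex hull of `X_v = {Σ_{j ∈ J} d j : Σ_{j ∈ J} g j = v}` has at most `2 (2 (cN + 1)^s)^k + 2` extreme points
(`ncard_extremePoints_le_card_uniqueMax` and `multiLevelSetPhi_le`): `N^{O(s log (cN))}`, uniformly in the number of
products of the rank-`s` design whose support this is. [folklore] -/
theorem multiLevelSetHull_quasi (s k N c : ℕ) (v : Fin s → ℕ) (hN : N ≤ 2 ^ k) (g : Fin N → Fin s → ℕ)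
    (hg0 : ∀ j, g j ≠ 0) (hgc : ∀ j i, g j i ≤ c) (d : Fin N → (Fin 2 →₀ ℕ)) :
    (Set.extremePoints ℝ (convexHull ℝ ((fun e : Fin 2 →₀ ℕ => fun i : Fin 2 => ((e i : ℕ) : ℝ)) ''
      (((Finset.univ.filter fun J : Finset (Fin N) => ∑ j ∈ J, g j = v).image
        fun J => ∑ j ∈ J, d j : Finset (Fin 2 →₀ ℕ)) : Set (Fin 2 →₀ ℕ))))).ncard ≤
      2 * (2 * (c * N + 1) ^ s) ^ k + 2 := by
  classical
  obtain ⟨U, hU⟩ : ∃ U : ℝ → Finset (Fin 2 →₀ ℕ) → Finset (Fin 2 →₀ ℕ),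
      ∀ (σ : ℝ) (S : Finset (Fin 2 →₀ ℕ)) (s : Fin 2 →₀ ℕ), s ∈ U σ S ↔ s ∈ S ∧
        ∃ t : ℝ, ∀ s' ∈ S, s' ≠ s →
          t * ((s' 0 : ℕ) : ℝ) + σ * ((s' 1 : ℕ) : ℝ) < t * ((s 0 : ℕ) : ℝ) + σ * ((s 1 : ℕ) : ℝ) :=
    ⟨fun σ S => S.filter fun s => ∃ t : ℝ, ∀ s' ∈ S, s' ≠ s →
        t * ((s' 0 : ℕ) : ℝ) + σ * ((s' 1 : ℕ) : ℝ) < t * ((s 0 : ℕ) : ℝ) + σ * ((s 1 : ℕ) : ℝ),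
      fun σ S s => by simp only [Finset.mem_filter]⟩
  exact (ncard_extremePoints_le_card_uniqueMax U hU _).trans
    (Nat.add_le_add_right (multiLevelSetPhi_le U hU s k N c v hN g hg0 hgc d) 2)

end Summit.ValiantsHypothesis.ValiantsHypothesis.Theorems.NewtonUnitEquationsNewtonTauWeak

end
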